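import Summits.KontsevichZagierPeriods.KontsevichZagierPeriods.Theorems.XMapPeriodTransfer.Negative.ValueSide
import Literature.NumberTheory.Transcendental.SemialgebraicMapsProofs

/-!
# `XMapPeriodTransfer`: the value side, II — non-vacuity, and `r.value = r'.value` is load-bearing

Negative knowledge for the crux `IsogenyCertificates.XMapPeriodTransfer`
(stmt-KontsevichZagierPeriods-10665; refuter, cdisprove). No new definitions; witnesses inline.

* `exists_rep_fermat`: the `r`-hypotheses of the crux are INHABITED — `[{x³+1>0}, a/√(x³+1)]` is a
  genuine `KZ.IntegralRep 1` (`ℚ`-semialgebraic domain and integrand via the tree's Tarski–Seidenberg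
  facts `IsSemialgebraicFunOn.mul_holds/sqrt_holds`; integrability: `≤ 2(x+1)^{−1/2}` near `−1`,
  `≤ x^{−3/2}` at `∞`);
* `false_without_valueEq`: the crux with `r.value = r'.value` DELETED is FALSE (witness
  `(A,B) = (A′,B′) = (0,1)`, identity datum `(X,1,1)`, `(a,b) = (2,1)`: soundness would give `2Ω = Ω`,
  `Ω > 0`) — **any proof must use the value hypothesis**;
* `false_with_commensurable_values`: weakening it to `∃ q : ℚ, r.value = q · r'.value` is FALSE too.
Companion work file: `Cruxes/XMapPeriodTransfer/Disproof.lean`.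
-/

noncomputable section

namespace Summit.KontsevichZagierPeriods.IsogenyCertificates.XMapPeriodTransferValue

open Polynomial Set MeasureTheory
open Literature.NumberTheory.Transcendental
open Summit.KontsevichZagierPeriods.KontsevichZagierPeriods.Theses.IsogenyCertificates

/-! ### Non-vacuity: an explicit representation for `y² = x³ + 1` -/

/-- `{P > 0} ⊆ ℝ¹` is `ℚ`-semialgebraic. [cite: KontsevichZagier2001, §1.1] -/
theorem isSemialgebraic_setOf_cubic_pos (A B : ℤ) :
    Literature.ModelTheory.ExponentialFields.IsSemialgebraic ℚ {x : Fin 1 → ℝ | 0 < x 0 ^ 3 + (A : ℝ) * x 0 + (B : ℝ)} := by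
  have h := Literature.ModelTheory.ExponentialFields.isSemialgebraic_setOf_eval_pos (k := ℚ) (R := ℝ)
    (MvPolynomial.X 0 ^ 3 + MvPolynomial.C (A : ℚ) * MvPolynomial.X 0 + MvPolynomial.C (B : ℚ) :
      MvPolynomial (Fin 1) ℚ)
  convert h using 2 with x
  simp

/-- `x ↦ a/√P(x)` is `ℚ`-semialgebraic on `{P > 0}`: it agrees there with `√P · (a/P)`
(Tarski–Seidenberg via the tree's `IsSemialgebraicFunOn.mul_holds` / `sqrt_holds`).
[cite: BochnakCosteRoy1998, Prop. 2.2.6] -/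
theorem isSemialgebraicFunOn_integrand (A B : ℤ) (a : ℚ) :
    IsSemialgebraicFunOn ℚ {x : Fin 1 → ℝ | 0 < x 0 ^ 3 + (A : ℝ) * x 0 + (B : ℝ)}
      (fun x => (a : ℝ) / Real.sqrt (x 0 ^ 3 + (A : ℝ) * x 0 + (B : ℝ))) := by
  set P : MvPolynomial (Fin 1) ℚ :=
    MvPolynomial.X 0 ^ 3 + MvPolynomial.C (A : ℚ) * MvPolynomial.X 0 + MvPolynomial.C (B : ℚ) with hPdef
  have hP : ∀ x : Fin 1 → ℝ, MvPolynomial.aeval x P = (x 0 ^ 3 + (A : ℝ) * x 0 + (B : ℝ)) := fun x => by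
    simp [hPdef]
  have hs := isSemialgebraic_setOf_cubic_pos A B
  have h1 : IsSemialgebraicFunOn ℚ {x : Fin 1 → ℝ | 0 < x 0 ^ 3 + (A : ℝ) * x 0 + (B : ℝ)} (fun x => MvPolynomial.aeval x P) :=
    isSemialgebraicFunOn_aeval hs P
  have h2 := IsSemialgebraicFunOn.sqrt_holds h1
  have h3 : IsSemialgebraicFunOn ℚ {x : Fin 1 → ℝ | 0 < x 0 ^ 3 + (A : ℝ) * x 0 + (B : ℝ)}
      (fun x => MvPolynomial.aeval x (MvPolynomial.C a) / MvPolynomial.aeval x P) :=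
    isSemialgebraicFunOn_aeval_div_aeval hs _ _ fun x hx => by rw [hP]; exact (ne_of_gt hx)
  have h4 := IsSemialgebraicFunOn.mul_holds h2 h3
  refine h4.congr fun x hx => ?_
  have hx' : 0 < (x 0 ^ 3 + (A : ℝ) * x 0 + (B : ℝ)) := hx
  simp only [Pi.mul_apply, hP, MvPolynomial.algHom_C, eq_ratCast]
  have hs0 : Real.sqrt (x 0 ^ 3 + (A : ℝ) * x 0 + (B : ℝ)) ≠ 0 := (Real.sqrt_pos.2 hx').ne'
  rw [eq_div_iff hs0]
  have hcc : Real.sqrt (x 0 ^ 3 + (A : ℝ) * x 0 + (B : ℝ)) * Real.sqrt (x 0 ^ 3 + (A : ℝ) * x 0 + (B : ℝ)) = (x 0 ^ 3 + (A : ℝ) * x 0 + (B : ℝ)) := Real.mul_self_sqrt hx'.le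
  calc Real.sqrt (x 0 ^ 3 + (A : ℝ) * x 0 + (B : ℝ)) * ((a : ℝ) / (x 0 ^ 3 + (A : ℝ) * x 0 + (B : ℝ))) * Real.sqrt (x 0 ^ 3 + (A : ℝ) * x 0 + (B : ℝ))
      = (Real.sqrt (x 0 ^ 3 + (A : ℝ) * x 0 + (B : ℝ)) * Real.sqrt (x 0 ^ 3 + (A : ℝ) * x 0 + (B : ℝ))) * ((a : ℝ) / (x 0 ^ 3 + (A : ℝ) * x 0 + (B : ℝ))) := by ring
    _ = (x 0 ^ 3 + (A : ℝ) * x 0 + (B : ℝ)) * ((a : ℝ) / (x 0 ^ 3 + (A : ℝ) * x 0 + (B : ℝ))) := by rw [hcc]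
    _ = (a : ℝ) := mul_div_cancel₀ _ hx'.ne'

/-- `t³ + 1 > 0 ↔ t > −1`. [folklore] -/
theorem cube_add_one_pos_iff (t : ℝ) : 0 < t ^ 3 + 1 ↔ -1 < t := by
  have h : t ^ 3 + 1 = (t + 1) * (t ^ 2 - t + 1) := by ring
  have hq : 0 < t ^ 2 - t + 1 := by nlinarith [sq_nonneg (t - 1/2)]
  rw [h]
  constructor
  · intro hp
    by_contra hle
    nlinarith [mul_le_mul_of_nonneg_right (not_lt.mp hle) hq.le]
  · intro ht; exact mul_pos (by linarith) hq

/-- `dt/√(t³ + 1)` is integrable on `(−1, ∞)`: `≤ 2(t+1)^{−1/2}` on `(−1, 1]`, `≤ t^{−3/2}` on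
`(1, ∞)`. [folklore] -/
theorem integrableOn_inv_sqrt_cube_add_one :
    IntegrableOn (fun t : ℝ => 1 / Real.sqrt (t ^ 3 + 1)) (Ioi (-1)) := by
  have hmeas : Measurable fun t : ℝ => 1 / Real.sqrt (t ^ 3 + 1) := by fun_prop
  rw [← Ioc_union_Ioi_eq_Ioi (show (-1 : ℝ) ≤ 1 by norm_num)]
  refine IntegrableOn.union ?_ ?_
  · have hg : IntegrableOn (fun t : ℝ => 2 * (t + 1) ^ (-(1 / 2 : ℝ))) (Ioc (-1) 1) := by
      have h1 : IntervalIntegrable (fun x : ℝ => x ^ (-(1 / 2 : ℝ))) volume 0 2 :=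
        intervalIntegral.intervalIntegrable_rpow' (by norm_num)
      have h2 := h1.comp_add_right 1
      have h3 : IntervalIntegrable (fun x : ℝ => (x + 1) ^ (-(1 / 2 : ℝ))) volume (-1) 1 := by
        convert h2 using 2 <;> norm_num
      have h4 := (intervalIntegrable_iff_integrableOn_Ioc_of_le (by norm_num : (-1 : ℝ) ≤ 1)).mp h3
      exact h4.const_mul 2
    refine Integrable.mono' hg hmeas.aestronglyMeasurable ?_
    filter_upwards [ae_restrict_mem measurableSet_Ioc] with t ht
    rw [Real.norm_eq_abs, abs_of_nonneg (div_nonneg zero_le_one (Real.sqrt_nonneg _))]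
    have ht1 : 0 < t + 1 := by linarith [ht.1]
    have hP : 0 < t ^ 3 + 1 := (cube_add_one_pos_iff t).2 ht.1
    rw [Real.rpow_neg ht1.le, ← Real.sqrt_eq_rpow, ← div_eq_mul_inv,
      div_le_div_iff₀ (Real.sqrt_pos.2 hP) (Real.sqrt_pos.2 ht1), one_mul]
    have h4 : Real.sqrt 4 = 2 := by
      rw [show (4 : ℝ) = 2 ^ 2 by norm_num, Real.sqrt_sq (by norm_num)]
    calc Real.sqrt (t + 1) ≤ Real.sqrt (4 * (t ^ 3 + 1)) :=
          Real.sqrt_le_sqrt (by nlinarith [sq_nonneg (2 * t - 1)])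
      _ = 2 * Real.sqrt (t ^ 3 + 1) := by rw [Real.sqrt_mul (by norm_num), h4]
  · have hg : IntegrableOn (fun t : ℝ => t ^ (-(3 / 2) : ℝ)) (Ioi 1) :=
      integrableOn_Ioi_rpow_of_lt (by norm_num) one_pos
    refine Integrable.mono' hg hmeas.aestronglyMeasurable ?_
    filter_upwards [ae_restrict_mem measurableSet_Ioi] with t ht
    rw [Real.norm_eq_abs, abs_of_nonneg (div_nonneg zero_le_one (Real.sqrt_nonneg _))]
    have ht0 : 0 < t := by linarith [ht.out]
    rw [Real.rpow_neg ht0.le, ← one_div]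
    apply one_div_le_one_div_of_le (Real.rpow_pos_of_pos ht0 _)
    have h32 : t ^ ((3 / 2 : ℝ)) = Real.sqrt (t ^ 3) := by
      rw [Real.sqrt_eq_rpow, ← Real.rpow_natCast t 3, ← Real.rpow_mul ht0.le]; norm_num
    rw [h32]
    exact Real.sqrt_le_sqrt (by linarith)

/-- **NON-VACUITY.** The `r`-hypotheses of the crux are inhabited: for every `a : ℚ` there is a
`KZ.IntegralRep 1` with domain `{x³ + 0·x + 1 > 0}` and integrand `a/√(x³ + 0·x + 1)` (literal shape,
`(A, B) = (0, 1)`, nonsingular since `4·0 + 27·1 ≠ 0`). [cite: KontsevichZagier2001, §1.1] -/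
theorem exists_rep_fermat (a : ℚ) : ∃ r : KZ.IntegralRep 1,
    r.domain = {x : Fin 1 → ℝ | 0 < x 0 ^ 3 + ((0:ℤ) : ℝ) * x 0 + ((1:ℤ) : ℝ)} ∧
    r.integrand = fun x => (a : ℝ) / Real.sqrt (x 0 ^ 3 + ((0:ℤ) : ℝ) * x 0 + ((1:ℤ) : ℝ)) := by
  have hmp := MeasureTheory.volume_preserving_funUnique (Fin 1) ℝ
  have hset : {x : Fin 1 → ℝ | 0 < x 0 ^ 3 + ((0:ℤ) : ℝ) * x 0 + ((1:ℤ) : ℝ)} =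
      (MeasurableEquiv.funUnique (Fin 1) ℝ) ⁻¹' Ioi (-1) := by
    ext x
    simp [MeasurableEquiv.funUnique, Fin.default_eq_zero, cube_add_one_pos_iff]
  have hint : IntegrableOn (fun x : Fin 1 → ℝ => (a : ℝ) / Real.sqrt (x 0 ^ 3 + ((0:ℤ) : ℝ) * x 0 + ((1:ℤ) : ℝ)))
      {x : Fin 1 → ℝ | 0 < x 0 ^ 3 + ((0:ℤ) : ℝ) * x 0 + ((1:ℤ) : ℝ)} := by
    rw [hset]
    have h := (hmp.integrableOn_comp_preimage (MeasurableEquiv.measurableEmbedding _)).mpr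
      (integrableOn_inv_sqrt_cube_add_one.const_mul (a : ℝ))
    refine IntegrableOn.congr_fun h (fun x _ => ?_) (measurableSet_Ioi.preimage (MeasurableEquiv.measurable _))
    simp [MeasurableEquiv.funUnique, Fin.default_eq_zero, div_eq_mul_inv]
  exact ⟨{ domain := {x : Fin 1 → ℝ | 0 < x 0 ^ 3 + ((0:ℤ) : ℝ) * x 0 + ((1:ℤ) : ℝ)},
           integrand := fun x => (a : ℝ) / Real.sqrt (x 0 ^ 3 + ((0:ℤ) : ℝ) * x 0 + ((1:ℤ) : ℝ)),
           isSemialgebraic_domain := isSemialgebraic_setOf_cubic_pos 0 1,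
           isSemialgebraicFunOn_integrand := isSemialgebraicFunOn_integrand 0 1 a,
           integrableOn := hint }, rfl, rfl⟩

/-! ### `r.value = r'.value` is load-bearing -/

/-- **Any proof of the crux must use `r.value = r'.value`**: the crux with that hypothesis DELETED
(everything else verbatim) is FALSE. Witness `(A,B) = (A′,B′) = (0,1)`, the identity datum
`(f,g,c) = (X,1,1)`, `(a,b) = (2,1)`, `r = [{x³+1>0}, 2/√(x³+1)]`, `r′ = [{x³+1>0}, 1/√(x³+1)]`:
soundness of the calculus (`KZ.Equivalent.value_eq_holds`) would give `2Ω = Ω` with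
`Ω = ∫_{−1}^∞ dx/√(x³+1) > 0`. [folklore] -/
theorem false_without_valueEq : ¬ (∀ (A B A' B' : ℤ), 4 * A ^ 3 + 27 * B ^ 2 ≠ 0 → 4 * A' ^ 3 + 27 * B' ^ 2 ≠ 0 →
    ∀ (f g : ℚ[X]) (c : ℚ), derivative f * g - f * derivative g ≠ 0 →
      C (c ^ 2) * g * (f ^ 3 + C (A' : ℚ) * f * g ^ 2 + C (B' : ℚ) * g ^ 3) =
        (X ^ 3 + C (A : ℚ) * X + C (B : ℚ)) * (derivative f * g - f * derivative g) ^ 2 →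
    ∀ (a b : ℚ), 0 < a → 0 < b → ∀ (r r' : KZ.IntegralRep 1),
      r.domain = {x | 0 < x 0 ^ 3 + (A : ℝ) * x 0 + (B : ℝ)} →
      EqOn r.integrand (fun x => (a : ℝ) / Real.sqrt (x 0 ^ 3 + (A : ℝ) * x 0 + (B : ℝ))) r.domain →
      r'.domain = {x | 0 < x 0 ^ 3 + (A' : ℝ) * x 0 + (B' : ℝ)} →
      EqOn r'.integrand (fun x => (b : ℝ) / Real.sqrt (x 0 ^ 3 + (A' : ℝ) * x 0 + (B' : ℝ))) r'.domain →
       KZ.Equivalent r r') := by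
  intro h
  obtain ⟨r2, hd2, hi2⟩ := exists_rep_fermat 2
  obtain ⟨r1, hd1, hi1⟩ := exists_rep_fermat 1
  have hW : derivative (X : ℚ[X]) * 1 - X * derivative 1 ≠ 0 := by simp
  have hI : C ((1 : ℚ) ^ 2) * (1 : ℚ[X]) * (X ^ 3 + C ((0 : ℤ) : ℚ) * X * 1 ^ 2 + C ((1 : ℤ) : ℚ) * 1 ^ 3) =
      (X ^ 3 + C ((0 : ℤ) : ℚ) * X + C ((1 : ℤ) : ℚ)) * (derivative X * 1 - X * derivative 1) ^ 2 := by
    simp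
  have h2 : KZ.Equivalent r2 r1 :=
    h 0 1 0 1 (by norm_num) (by norm_num) X 1 1 hW hI 2 1 (by norm_num) (by norm_num)
      r2 r1 hd2 (fun x _ => by rw [hi2]) hd1 (fun x _ => by rw [hi1])
  have hv : r2.value = r1.value := KZ.Equivalent.value_eq_holds h2
  rw [value_eq (A := 0) (B := 1) (a := 2) r2 hd2 (fun x _ => by rw [hi2]),
    value_eq (A := 0) (B := 1) (a := 1) r1 hd1 (fun x _ => by rw [hi1])] at hv
  have hΩ := period_pos (A := 0) (B := 1)
    (integrableOn_of_rep (a := 1) r1 hd1 (fun x _ => by rw [hi1]) one_ne_zero)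
  push_cast at hv
  linarith

/-- **Commensurability of the values does not suffice either**: weakening `r.value = r'.value` to
`∃ q : ℚ, r.value = q · r'.value` gives a FALSE statement (same witness, `q = 2`). The relation
`[r] − [r′]` needs exact equality; `aΩ = q·bΩ′` is the relation `[r] ~ [q·r′]`. [folklore] -/
theorem false_with_commensurable_values : ¬ (∀ (A B A' B' : ℤ), 4 * A ^ 3 + 27 * B ^ 2 ≠ 0 → 4 * A' ^ 3 + 27 * B' ^ 2 ≠ 0 →
    ∀ (f g : ℚ[X]) (c : ℚ), derivative f * g - f * derivative g ≠ 0 →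
      C (c ^ 2) * g * (f ^ 3 + C (A' : ℚ) * f * g ^ 2 + C (B' : ℚ) * g ^ 3) =
        (X ^ 3 + C (A : ℚ) * X + C (B : ℚ)) * (derivative f * g - f * derivative g) ^ 2 →
    ∀ (a b : ℚ), 0 < a → 0 < b → ∀ (r r' : KZ.IntegralRep 1),
      r.domain = {x | 0 < x 0 ^ 3 + (A : ℝ) * x 0 + (B : ℝ)} →
      EqOn r.integrand (fun x => (a : ℝ) / Real.sqrt (x 0 ^ 3 + (A : ℝ) * x 0 + (B : ℝ))) r.domain →
      r'.domain = {x | 0 < x 0 ^ 3 + (A' : ℝ) * x 0 + (B' : ℝ)} →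
      EqOn r'.integrand (fun x => (b : ℝ) / Real.sqrt (x 0 ^ 3 + (A' : ℝ) * x 0 + (B' : ℝ))) r'.domain →
      (∃ q : ℚ, r.value = (q : ℝ) * r'.value) → KZ.Equivalent r r') := by
  intro h
  obtain ⟨r2, hd2, hi2⟩ := exists_rep_fermat 2
  obtain ⟨r1, hd1, hi1⟩ := exists_rep_fermat 1
  have hW : derivative (X : ℚ[X]) * 1 - X * derivative 1 ≠ 0 := by simp
  have hI : C ((1 : ℚ) ^ 2) * (1 : ℚ[X]) * (X ^ 3 + C ((0 : ℤ) : ℚ) * X * 1 ^ 2 + C ((1 : ℤ) : ℚ) * 1 ^ 3) =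
      (X ^ 3 + C ((0 : ℤ) : ℚ) * X + C ((1 : ℤ) : ℚ)) * (derivative X * 1 - X * derivative 1) ^ 2 := by
    simp
  have hv2 := value_eq (A := 0) (B := 1) (a := 2) r2 hd2 (fun x _ => by rw [hi2])
  have hv1 := value_eq (A := 0) (B := 1) (a := 1) r1 hd1 (fun x _ => by rw [hi1])
  have h2 : KZ.Equivalent r2 r1 :=
    h 0 1 0 1 (by norm_num) (by norm_num) X 1 1 hW hI 2 1 (by norm_num) (by norm_num)
      r2 r1 hd2 (fun x _ => by rw [hi2]) hd1 (fun x _ => by rw [hi1])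
      ⟨2, by rw [hv2, hv1]; push_cast; ring⟩
  have hv : r2.value = r1.value := KZ.Equivalent.value_eq_holds h2
  rw [hv2, hv1] at hv
  have hΩ := period_pos (A := 0) (B := 1)
    (integrableOn_of_rep (a := 1) r1 hd1 (fun x _ => by rw [hi1]) one_ne_zero)
  push_cast at hv
  linarith

end Summit.KontsevichZagierPeriods.IsogenyCertificates.XMapPeriodTransferValue
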